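import Literature.AnabelianGeometry.AbsoluteAnabelian.MonoidKummerTransportCanonical
import Literature.AnabelianGeometry.AbsoluteAnabelian.GaloisPadicLogInstance
import Literature.AnabelianGeometry.AbsoluteAnabelian.MLFGaloisMonoAnalyticModel
import HarnessLib

/-!
# [AbsTopIII] Def 3.1 (ii): `GaloisMonoidPair.ModelPresentation` is inhabited — every model presents
# itself; a GENUINE instance over `ℚ_p` (abc-iut-w5-d197, gen 2)

S. Mochizuki, *Topics in absolute anabelian geometry III* (2015) [AbsTopIII], Def 3.1 (ii) p. 67: an
MLF-Galois `TM`-pair is a pair `(Π ↷ M)` "isomorphic to the model object `(Π_k ↷ 𝒪^⊳_k̄)`"; abc-iut-L4-t2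
types the witness as `GaloisMonoidPair.ModelPresentation P` (`MonoidKummerTransportCanonical.lean`, with
the criterion `ModelPresentation.nonempty_iff : Nonempty P.ModelPresentation ↔ IsMLFGaloisMonoidPair .TM P`).
The inhabitation census sees neither an `Iff` nor a functor as a producer, so the row read ZERO (v4,
08:02Z list).  This PROOF-ONLY file (no `def`/`instance`/`structure`) records the direct producers:

* `ModelPresentation.nonempty_tmPair` — the model pair `D.tmPair` of ANY model data `(C, D)` presents
  itself (isomorphism of pairs = identity);
* `ModelPresentation.exists_padic_galois` — GENUINE closed instance: `k := ℚ_p`, `k̄ := ℚ̄_p`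
  (abc-iut-L4's `MLFClosure.padic`), `Π_k := G_k` with `ε_k = id` (the mono-analytic model
  `ModelMLFGaloisData.galois`): the pair `(G_{ℚ_p} ↷ 𝒪^⊳_{ℚ̄_p})` has a model presentation.

No side taken on [IUTchIII] Cor 3.12; a witness is consistency evidence, not an endorsement; typed ≠ proved.
-/

namespace Literature.AnabelianGeometry.AbsoluteAnabelian

open _root_.CategoryTheory

universe u

/-- **[AbsTopIII] Def 3.1 (ii)** — the model pair `(Π_k ↷ 𝒪^⊳_k̄)` of any model data presents itself
(the identity isomorphism of pairs). [cite: MochizukiAbsTopIII2015, Definition 3.1 (ii) p.67] -/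
theorem GaloisMonoidPair.ModelPresentation.nonempty_tmPair (C : MLFClosure.{u})
    (D : ModelMLFGaloisData C.k C.K) : Nonempty (GaloisMonoidPair.ModelPresentation D.tmPair) :=
  ⟨{ C := C
     D := D
     iso := { isoPi := ContinuousMulEquiv.refl _, isoM := MulEquiv.refl _, smul_comm := fun _ _ => rfl } }⟩

/-- **GENUINE closed instance over `ℚ_p`**: the mono-analytic model pair `(G_{ℚ_p} ↷ 𝒪^⊳_{ℚ̄_p})`
(`MLFClosure.padic`, `ModelMLFGaloisData.galois`) has a model presentation; in particular some
`GaloisMonoidPair` does. [cite: MochizukiAbsTopIII2015, Definition 3.1 (ii) p.67] -/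
theorem GaloisMonoidPair.ModelPresentation.exists_padic_galois (p : ℕ) [Fact p.Prime] :
    ∃ P : GaloisMonoidPair.{0}, Nonempty P.ModelPresentation :=
  ⟨_, GaloisMonoidPair.ModelPresentation.nonempty_tmPair (MLFClosure.padic p)
    (ModelMLFGaloisData.galois (MLFClosure.padic p).k (MLFClosure.padic p).K)⟩

/-- Hence the model pair over `ℚ_p` IS an MLF-Galois `TM`-pair in abc-iut-L4-t2's sense (through
`ModelPresentation.nonempty_iff`). [cite: MochizukiAbsTopIII2015, Definition 3.1 (ii) p.67] -/
theorem GaloisMonoidPair.ModelPresentation.isMLFGaloisMonoidPair_padic_galois (p : ℕ) [Fact p.Prime] :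
    IsMLFGaloisMonoidPair .TM
      (ModelMLFGaloisData.galois (MLFClosure.padic p).k (MLFClosure.padic p).K).tmPair :=
  GaloisMonoidPair.ModelPresentation.nonempty_iff.1
    (GaloisMonoidPair.ModelPresentation.nonempty_tmPair (MLFClosure.padic p) _)

end Literature.AnabelianGeometry.AbsoluteAnabelian
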